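import Summits.ABC.ABC.Theses.IneffectiveSubspace
import Summits.ABC.ABC.Theorems.IneffectiveSubspaceTowerFourGivesDepthCounted

/-!
# Stub `stub_dictionary` of line `Sketch` — crux `IneffectiveSubspace.DepthCountedABC` (stmt-ABC-14938)

THE DICTIONARY `LW4 → S4SmallMemberABC`.

* Hypothesis (`LW4`, unfolded): a Lang–Waldschmidt-type lower bound for the single linear form
  `Λ(x) = Σ_{j<4} (j+1) · log x_j` in four logarithms of positive rationals `x : Fin 4 → ℚ`, measured
  against the multiplicative height `H(x) = ∏_j |num x_j| · den x_j`: for every `ε > 0` some `C > 0`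
  with `C⁻¹ · H(x)^(−(1+ε)) ≤ |Λ(x)|` whenever `Λ(x) ≠ 0`.
* Conclusion (`S4SmallMemberABC`, unfolded): abc with the member `a` at FULL SIZE and `b, c` charged
  through the level-4 radical `S₄(n) := ∏_{p ∣ n} p^⌈v_p(n)/4⌉ = ∏ p ∈ n.primeFactors, p ^ ((v_p(n)+3)/4)`:
  for every `ε > 0` some `C > 0` with `c ≤ C · a · (S₄(b)·S₄(c))^(1+ε)` on every abc triple.

Proof.  Fix `ε`, take `C` from the hypothesis and output `C + 1`.  For an abc triple `(a, b, c)` lift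
`b` and `c` optimally to level `4` (`TowerFourGivesDepthCounted.exists_lift`): `y, z : Fin 4 → ℕ`,
all entries `≥ 1`, `∏ y_j^(j+1) = b`, `∏ z_j^(j+1) = c`, `v_p(∏ y_j) = ⌈v_p(b)/4⌉`,
`v_p(∏ z_j) = ⌈v_p(c)/4⌉`; comparing factorizations, `∏ y_j = S₄(b)` and `∏ z_j = S₄(c)`.  Put
`x_j := z_j / y_j ∈ ℚ_{>0}`.  Since `z_j ∣ c`, `y_j ∣ b` and `gcd(b, c) = 1`, the fraction is reduced:
`num x_j = z_j`, `den x_j = y_j`, so `H(x) = (∏ z_j)(∏ y_j) = S₄(b)·S₄(c)`.  The linear form telescopes: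
`Λ(x) = Σ (j+1)(log z_j − log y_j) = log c − log b`, which is `> 0` (`c > b ≥ 1`) and
`≤ c/b − 1 = a/b` (`log t ≤ t − 1`).  The hypothesis at `x` reads `C⁻¹ · S^(−(1+ε)) ≤ a/b`,
`S := S₄(b)S₄(c) ≥ 1`, i.e. `b ≤ C · a · S^(1+ε)`, and `c = a + b ≤ a·S^(1+ε) + C·a·S^(1+ε)`.

Sources: skeleton `Cruxes/DepthCountedABC/Lines/Sketch.lean` of lead `prover-line-stmt-ABC-14938-0`
(stub 2, `stub_dictionary`; card `depth-grouped-four-logarithms`).  The optimal lift is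
`Summit.ABC.ABC.Theorems.TowerFourGivesDepthCounted.exists_lift` (Vojta 2000 §3.1 at level `4`,
landed in `Theorems/IneffectiveSubspaceTowerFourGivesDepthCounted.lean`).  Mathlib only otherwise
(`Rat.num_div_eq_of_coprime`, `Rat.den_div_eq_of_coprime`, `Real.log_prod`, `Real.log_pow`,
`Real.log_div`, `Real.log_le_sub_one_of_pos`, `Real.rpow_neg`, `Real.one_le_rpow`,
`Nat.eq_of_factorization_eq`, `Nat.prod_pow_factorization_eq_self`).  Deliberately NOT here: `LW4`
itself, the base transfer `S4SmallMemberABC → SmallFullSizeFiveFree`, the deep cells, the power-rich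
residual and the assembly (the other stubs of the line), and the converse `S4SmallMemberABC → LW4`.
-/

-- `Summit.<Summit>.<Problem>` is the mandated summit-side namespace (CONVENTIONS §2); for the
-- single-conjunct summit `ABC` the two coincide, so the duplicate `ABC.ABC` is deliberate.
set_option linter.dupNamespace false

namespace Summit.ABC.ABC.Theorems.DepthCountedABC

open scoped BigOperators

/-- The level-4 radical `S₄(m) = ∏_{p ∣ m} p^⌈v_p(m)/4⌉` has `v_p(S₄(m)) = ⌈v_p(m)/4⌉ = (v_p(m)+3)/4`
for every `p`. [folklore] -/
theorem stubDictionary_factorization_S4 (m p : ℕ) :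
    (∏ q ∈ m.primeFactors, q ^ ((m.factorization q + 3) / 4)).factorization p =
      (m.factorization p + 3) / 4 := by
  -- adapted from `Theorems/IneffectiveSubspaceTowerFourGivesDepthCounted.lean` (`exists_lift`, clause 3)
  have hF : (Finsupp.mapRange (fun e => (e + 3) / 4) (by norm_num) m.factorization).prod
      (· ^ ·) = ∏ q ∈ m.primeFactors, q ^ ((m.factorization q + 3) / 4) := by
    rw [Finsupp.prod_mapRange_index (h := (· ^ ·)) (fun _ => pow_zero _), Finsupp.prod,
      Nat.support_factorization]
  rw [← hF, Nat.prod_pow_factorization_eq_self, Finsupp.mapRange_apply]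
  exact fun q hq => Nat.prime_of_mem_primeFactors (Finsupp.support_mapRange hq)

/-- An optimal level-4 lift realises the level-4 radical: if all `y_i ≥ 1` and
`v_p(∏ y_i) = ⌈v_p(m)/4⌉` for every `p`, then `∏ y_i = S₄(m) = ∏_{p ∣ m} p^⌈v_p(m)/4⌉`. [folklore] -/
theorem stubDictionary_prod_lift_eq {m : ℕ} {y : Fin 4 → ℕ} (hy0 : ∀ i, 0 < y i)
    (hyf : ∀ p, (∏ i, y i).factorization p = (m.factorization p + 3) / 4) :
    (∏ i, y i) = ∏ q ∈ m.primeFactors, q ^ ((m.factorization q + 3) / 4) := by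
  refine Nat.eq_of_factorization_eq (Finset.prod_pos fun i _ => hy0 i).ne'
    (Finset.prod_pos fun q hq => pow_pos (Nat.prime_of_mem_primeFactors hq).pos _).ne' fun p => ?_
  rw [hyf, stubDictionary_factorization_S4]

/-- The members of a lift divide the lifted number: `y_j ∣ ∏ y_i^(i+1)`. [folklore] -/
theorem stubDictionary_dvd_of_lift (y : Fin 4 → ℕ) (j : Fin 4) :
    y j ∣ ∏ i, y i ^ (i.val + 1) :=
  (dvd_pow_self (y j) (Nat.succ_ne_zero _)).trans
    (Finset.dvd_prod_of_mem (fun i : Fin 4 => y i ^ (i.val + 1)) (Finset.mem_univ j))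

/-- The lifted number, read in `ℝ`: `(∏ y_i^(i+1) : ℝ) = ∏ (y_i : ℝ)^(i+1)`, and its logarithm is
`Σ (i+1) · log y_i`. [folklore] -/
theorem stubDictionary_log_lift (y : Fin 4 → ℕ) (hy0 : ∀ i, 0 < y i) :
    Real.log ((∏ i, y i ^ (i.val + 1) : ℕ) : ℝ) =
      ∑ i : Fin 4, ((i.val : ℝ) + 1) * Real.log (y i : ℝ) := by
  have hpos : ∀ i : Fin 4, (0 : ℝ) < (y i : ℝ) ^ (i.val + 1) := fun i =>
    pow_pos (by exact_mod_cast hy0 i) _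
  push_cast
  rw [Real.log_prod fun i _ => (hpos i).ne']
  refine Finset.sum_congr rfl fun i _ => ?_
  rw [Real.log_pow]
  push_cast
  ring

/-- **Stub `stub_dictionary` (the DICTIONARY `LW4 → S4SmallMemberABC`) of line `Sketch`, crux
`DepthCountedABC` (stmt-ABC-14938), fully unfolded.**  If for every `ε > 0` some `C > 0` gives
`C⁻¹ · H(x)^(−(1+ε)) ≤ |Σ_{j<4} (j+1) log x_j|` for all positive `x : Fin 4 → ℚ` with nonzero form
(`H(x) = ∏ |num x_j| · den x_j`), then for every `ε > 0` some `C > 0` gives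
`c ≤ C · a · (S₄(b)·S₄(c))^(1+ε)` on all abc triples (`S₄(n) = ∏_{p ∣ n} p^((v_p(n)+3)/4)`):
evaluate the form at `x_j = z_j / y_j` for optimal level-4 lifts `y` of `b` and `z` of `c`, where it
equals `log c − log b ∈ (0, a/b]` and `H(x) = S₄(b)S₄(c)`. [folklore] -/
theorem stub_dictionary :
    (∀ ε : ℝ, 0 < ε → ∃ C : ℝ, 0 < C ∧ ∀ x : Fin 4 → ℚ, (∀ j, 0 < x j) →
      (∑ j : Fin 4, ((j.val : ℝ) + 1) * Real.log ((x j : ℚ) : ℝ)) ≠ 0 →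
      C⁻¹ * ((∏ j : Fin 4, (x j).num.natAbs * (x j).den : ℕ) : ℝ) ^ (-(1 + ε)) ≤
        |∑ j : Fin 4, ((j.val : ℝ) + 1) * Real.log ((x j : ℚ) : ℝ)|) →
    ∀ ε : ℝ, 0 < ε → ∃ C : ℝ, 0 < C ∧ ∀ a b c : ℕ,
      Literature.NumberTheory.DiophantineGeometry.IsABCTriple a b c →
      (c : ℝ) ≤ C * (a : ℝ) *
        (((∏ p ∈ b.primeFactors, p ^ ((b.factorization p + 3) / 4)) *
          (∏ p ∈ c.primeFactors, p ^ ((c.factorization p + 3) / 4)) : ℕ) : ℝ) ^ (1 + ε) := by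
  intro hLW ε hε
  obtain ⟨C, hC, hLWC⟩ := hLW ε hε
  refine ⟨C + 1, by linarith, fun a b c habc => ?_⟩
  obtain ⟨ha, hb, hsum, hcop⟩ := habc
  have hc : 0 < c := by omega
  have hbc : Nat.Coprime b c := by
    rw [← hsum]; exact Nat.coprime_add_self_right.mpr hcop.symm
  -- optimal level-4 lifts of `b` and `c`
  obtain ⟨y, hy0, hyb, hyf⟩ := TowerFourGivesDepthCounted.exists_lift hb.ne'
  obtain ⟨z, hz0, hzc, hzf⟩ := TowerFourGivesDepthCounted.exists_lift hc.ne'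
  have hAy : (∏ i, y i) = ∏ p ∈ b.primeFactors, p ^ ((b.factorization p + 3) / 4) :=
    stubDictionary_prod_lift_eq hy0 hyf
  have hBz : (∏ i, z i) = ∏ p ∈ c.primeFactors, p ^ ((c.factorization p + 3) / 4) :=
    stubDictionary_prod_lift_eq hz0 hzf
  -- `z_j / y_j` is a reduced fraction
  have hcopj : ∀ j, Nat.Coprime (z j) (y j) := fun j =>
    Nat.Coprime.coprime_dvd_right (hyb ▸ stubDictionary_dvd_of_lift y j)
      (Nat.Coprime.coprime_dvd_left (hzc ▸ stubDictionary_dvd_of_lift z j) hbc.symm)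
  -- the point `x_j := z_j / y_j`
  obtain ⟨x, hx⟩ : ∃ x : Fin 4 → ℚ, x = fun j => ((z j : ℤ) : ℚ) / ((y j : ℤ) : ℚ) := ⟨_, rfl⟩
  have hxj : ∀ j, x j = ((z j : ℤ) : ℚ) / ((y j : ℤ) : ℚ) := fun j => by rw [hx]
  have hyZ : ∀ j, (0 : ℤ) < (y j : ℤ) := fun j => by exact_mod_cast hy0 j
  have hcopZ : ∀ j, Nat.Coprime ((z j : ℤ)).natAbs ((y j : ℤ)).natAbs := fun j => by
    simpa only [Int.natAbs_natCast] using hcopj j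
  have hxnum : ∀ j, (x j).num = (z j : ℤ) := fun j => by
    rw [hxj]; exact Rat.num_div_eq_of_coprime (hyZ j) (hcopZ j)
  have hxden : ∀ j, (x j).den = y j := fun j => by
    have h := Rat.den_div_eq_of_coprime (hyZ j) (hcopZ j)
    rw [hxj]; exact_mod_cast h
  have hxpos : ∀ j, 0 < x j := fun j => by
    rw [hxj]; exact div_pos (by exact_mod_cast hz0 j) (by exact_mod_cast hy0 j)
  have hxR : ∀ j, ((x j : ℚ) : ℝ) = (z j : ℝ) / (y j : ℝ) := fun j => by
    rw [hxj]; push_cast; rfl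
  -- the height of `x` is `S₄(b) · S₄(c)`
  have hH : (∏ j : Fin 4, (x j).num.natAbs * (x j).den) =
      (∏ p ∈ b.primeFactors, p ^ ((b.factorization p + 3) / 4)) *
        (∏ p ∈ c.primeFactors, p ^ ((c.factorization p + 3) / 4)) := by
    rw [← hAy, ← hBz, Finset.prod_mul_distrib, mul_comm]
    congr 1 <;> refine Finset.prod_congr rfl fun j _ => ?_
    · rw [hxden]
    · rw [hxnum, Int.natAbs_natCast]
  -- the linear form at `x` is `log c - log b`
  have hbR : (0 : ℝ) < b := by exact_mod_cast hb
  have hcR : (0 : ℝ) < c := by exact_mod_cast hc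
  have hΛ : (∑ j : Fin 4, ((j.val : ℝ) + 1) * Real.log ((x j : ℚ) : ℝ)) =
      Real.log c - Real.log b := by
    rw [← hzc, ← hyb, stubDictionary_log_lift z hz0, stubDictionary_log_lift y hy0,
      ← Finset.sum_sub_distrib]
    refine Finset.sum_congr rfl fun j _ => ?_
    rw [hxR, Real.log_div (by exact_mod_cast (hz0 j).ne') (by exact_mod_cast (hy0 j).ne')]
    ring
  have hΛpos : 0 < Real.log c - Real.log b :=
    sub_pos.mpr (Real.log_lt_log hbR (by exact_mod_cast (show b < c by omega)))
  have hne : (∑ j : Fin 4, ((j.val : ℝ) + 1) * Real.log ((x j : ℚ) : ℝ)) ≠ 0 := by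
    rw [hΛ]; exact hΛpos.ne'
  -- `|Λ| = log (c/b) ≤ c/b - 1 = a/b`
  have hba : Real.log c - Real.log b ≤ (a : ℝ) / b := by
    rw [← Real.log_div hcR.ne' hbR.ne']
    calc Real.log ((c : ℝ) / b) ≤ (c : ℝ) / b - 1 := Real.log_le_sub_one_of_pos (div_pos hcR hbR)
      _ = (a : ℝ) / b := by rw [← hsum, Nat.cast_add, add_div, div_self hbR.ne']; ring
  -- feed `x` to the hypothesis
  have key := hLWC x hxpos hne
  rw [hΛ, abs_of_pos hΛpos, hH] at key
  replace key := key.trans hba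
  -- real bookkeeping
  set S : ℕ := (∏ p ∈ b.primeFactors, p ^ ((b.factorization p + 3) / 4)) *
    (∏ p ∈ c.primeFactors, p ^ ((c.factorization p + 3) / 4)) with hSdef
  have hSpos : 0 < S := by
    rw [hSdef, ← hAy, ← hBz]
    exact mul_pos (Finset.prod_pos fun i _ => hy0 i) (Finset.prod_pos fun i _ => hz0 i)
  have hS1 : (1 : ℝ) ≤ (S : ℝ) := by exact_mod_cast hSpos
  have hT : (0 : ℝ) < (S : ℝ) ^ (1 + ε) := Real.rpow_pos_of_pos (by linarith) _
  have hT1 : (1 : ℝ) ≤ (S : ℝ) ^ (1 + ε) := Real.one_le_rpow hS1 (by linarith)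
  rw [Real.rpow_neg (by linarith), ← mul_inv, inv_eq_one_div,
    div_le_div_iff₀ (mul_pos hC hT) hbR, one_mul] at key
  -- `key : b ≤ a * (C * S^(1+ε))`
  have haR : (0 : ℝ) ≤ a := by exact_mod_cast ha.le
  calc (c : ℝ) = a + b := by rw [← hsum, Nat.cast_add]
    _ ≤ (a : ℝ) * (S : ℝ) ^ (1 + ε) + (a : ℝ) * (C * (S : ℝ) ^ (1 + ε)) :=
        add_le_add (le_mul_of_one_le_right haR hT1) key
    _ = (C + 1) * (a : ℝ) * (S : ℝ) ^ (1 + ε) := by ring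

end Summit.ABC.ABC.Theorems.DepthCountedABC
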